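import Summits.CriticalPhenomena.PercolationContinuityZ3.Theorems.PercNearOneGluingNoHeavyConstsFibrewiseBHK
import Literature.Probability.Percolation.PercolationEvents
import HarnessLib

/-!
# "One-copy repulsion" at measure level — PROVED (PAPER-2 track (ii), refinements of the fibrewise hard-core Harris programme)

builds on p205010 (kernel theorem, internal audit signed; external expert review pending).  Support file (`--supports
stmt-CriticalPhenomena-4575`), lead seat `prim-nh-lead-4575` (gen 106); memo `run/shared/lean/prim/prim-nh-lead-4575/LEAD-GEN106.md` §2(4).
Theorems only; no sorries; standard axioms.

CONTEXT.  The lead's gen-106 conjecture `Consts.OneCopyRepelBHK` ("one-copy repulsion", typed fibrewise in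
`…ConstsOneCopyBHK.lean`) asks, for a source set `S`, a repelled set `T`, increasing cluster predicates `P, Q` and the two copies
`(η₀, η₁)` of a two-copy fibre with union clusters `C₀ = C_S(η₀)`, `C₁ = C_S(η₁)`, that
`Σ_{pairs with C₀ ∩ T = ∅} (1_P(C₀) − 1_P(C₁))·(1_Q(C₀) − 1_Q(C₁)) ≥ 0` — only the FIRST copy is conditioned (to avoid `T`), the
second copy is free.  Summed over all fibres with the Bernstein weights of one weight vector `w` (Linusson's principle) this is a
statement about two INDEPENDENT copies `ω, ω′ ~ μ = prodBernoulli w`:  with `D = {S ↮ T}`, `A = {P(C_S)}`, `B = {Q(C_S)}`,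
`E⊗E[1_D(ω)·(1_A(ω) − 1_A(ω′))·(1_B(ω) − 1_B(ω′))] ≥ 0`, i.e. the MEASURE-LEVEL form
`μ(A ∩ D)·μ(B) + μ(B ∩ D)·μ(A) ≤ μ(A ∩ B ∩ D) + μ(D)·μ(A ∩ B)`.
* `Consts.oneCopyRepel_measure` — **THEOREM (this file): the displayed inequality, for every finite vertex type, all weights, all
  `S`, `T` and increasing `P, Q`.**  Proof in three lines: BHK's Theorem 1.3 with sets (tree: `setClusterEventExchange`) gives
  `μ(A∩B∩D)·μ(D) ≥ μ(A∩D)·μ(B∩D)`; Harris (`prodBernoulli_harris_via_fibres`) gives `μ(A∩B) ≥ μ(A)μ(B)`; Harris for an increasing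
  against a decreasing event (`prodBernoulli_harris_upper_lower_via_fibres`) gives `μ(A∩D) ≤ μ(A)μ(D)`, `μ(B∩D) ≤ μ(B)μ(D)`; and the
  polynomial identity `d·Φ = (x₀d − a₀b₀) + d²(x − ab) + (ad − a₀)(bd − b₀)` (`Φ` = RHS − LHS, `d = μ(D)`, `a₀ = μ(A∩D)`,
  `x₀ = μ(A∩B∩D)`, `x = μ(A∩B)`) exhibits `d·Φ` as a sum of three nonnegative terms (`Consts.oneCopyRepel_algebra`).
  `T = ∅`: twice Harris.  The FIBREWISE statement `Consts.OneCopyRepelBHK` is open (census-clean on all graphs `n ≤ 5` and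
  `n = 6, m ≤ 8`, lead gen 106) — exactly as BHK's Theorem 1.3 is a theorem while its fibrewise form PA-BERN (`Consts.FibrewiseBHK`)
  is open.  The companion one-copy CONTAINMENT statement (condition the first copy on `A ⊆ V(C_S)`) is NOT obtained this way:
  "positive association given `S ↔ v`" is false (memo §2(4)), and its measure-level form is open.
[cite: VandenbergHaggstromKahn2005, Thm. 1.3 (p. 6) with Remark 1 after Thm. 1.2 (p. 5)] [cite: Harris1960, Lemma 4.1] [cite: Linusson2011, Prop. 2.6]
-/

noncomputable section

namespace Summit.CriticalPhenomena.PercolationContinuityZ3.Theorems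

open MeasureTheory Set Literature.Probability.LatticeModels Literature.Probability.Percolation
open scoped Classical

namespace Consts

variable {V : Type*} [Fintype V]

/-- The real-arithmetic core of `oneCopyRepel_measure`: from BHK on the block `D` (`a₀·b₀ ≤ x₀·d`), Harris (`a·b ≤ x`) and Harris
increasing/decreasing (`a₀ ≤ a·d`, `b₀ ≤ b·d`): `a₀·b + b₀·a ≤ x₀ + d·x`.  Key identity:
`d·(x₀ + d·x − a₀·b − b₀·a) = (x₀·d − a₀·b₀) + d·d·(x − a·b) + (a·d − a₀)·(b·d − b₀)`. [folklore] -/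
theorem oneCopyRepel_algebra (a b x d a₀ b₀ x₀ : ℝ) (h1 : a₀ * b₀ ≤ x₀ * d) (h2 : a₀ ≤ a * d) (h3 : b₀ ≤ b * d)
    (h4 : a * b ≤ x) (n_d : 0 ≤ d) (n_a₀ : 0 ≤ a₀) (n_b₀ : 0 ≤ b₀) (n_x₀ : 0 ≤ x₀) :
    a₀ * b + b₀ * a ≤ x₀ + d * x := by
  have hprod : 0 ≤ (a * d - a₀) * (b * d - b₀) := mul_nonneg (by linarith) (by linarith)
  have key : d * (x₀ + d * x - a₀ * b - b₀ * a) =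
      (x₀ * d - a₀ * b₀) + d * d * (x - a * b) + (a * d - a₀) * (b * d - b₀) := by ring
  by_cases hd : d = 0
  · subst hd
    have ha : a₀ = 0 := le_antisymm (by simpa using h2) n_a₀
    have hb : b₀ = 0 := le_antisymm (by simpa using h3) n_b₀
    subst ha hb
    simpa using n_x₀
  · have hdpos : 0 < d := lt_of_le_of_ne n_d (Ne.symm hd)
    have hdd : 0 ≤ d * d * (x - a * b) := mul_nonneg (mul_nonneg n_d n_d) (by linarith)
    have hmul : 0 ≤ d * (x₀ + d * x - a₀ * b - b₀ * a) := by
      rw [key]; linarith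
    have hΦ : 0 ≤ x₀ + d * x - a₀ * b - b₀ * a := by
      by_contra hneg
      have hlt : x₀ + d * x - a₀ * b - b₀ * a < 0 := lt_of_not_ge hneg
      have : d * (x₀ + d * x - a₀ * b - b₀ * a) < 0 := mul_neg_of_pos_of_neg hdpos hlt
      linarith
    linarith

/-- **One-copy repulsion, measure level.**  For bond percolation `μ = prodBernoulli w` on a finite vertex type, source set `S`,
repelled set `T`, `D = {S ↮ T}` and two increasing events `A = {P(C_S)}`, `B = {Q(C_S)}` of the union cluster `C_S = ⋃_{s∈S} C_s`:
`μ(A ∩ D)·μ(B) + μ(B ∩ D)·μ(A) ≤ μ(A ∩ B ∩ D) + μ(D)·μ(A ∩ B)`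
(equivalently, for two independent copies `ω, ω′`: `E[1_D(ω)(1_A(ω) − 1_A(ω′))(1_B(ω) − 1_B(ω′))] ≥ 0` — repelling ONE copy from
`T` keeps the two increasing cluster events "more aligned within the copy than across copies").  From BHK's Theorem 1.3 with sets,
Harris' inequality twice, and `oneCopyRepel_algebra`.
[cite: VandenbergHaggstromKahn2005, Thm. 1.3 (p. 6) with Remark 1 after Thm. 1.2 (p. 5)] [cite: Harris1960, Lemma 4.1] -/
theorem oneCopyRepel_measure (w : Sym2 V → unitInterval) (S T : Set V)
    (P Q : Set (Sym2 V) → Prop) (hP : ∀ ⦃C C' : Set (Sym2 V)⦄, C ⊆ C' → P C → P C')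
    (hQ : ∀ ⦃C C' : Set (Sym2 V)⦄, C ⊆ C' → Q C → Q C') :
    (prodBernoulli w).real ({ω : BondConfig V | P (⋃ s ∈ S, openEdgeCluster ω s)} ∩
          {ω : BondConfig V | ∀ s ∈ S, ∀ t ∈ T, ¬ (openGraph ω).Reachable s t}) *
        (prodBernoulli w).real {ω : BondConfig V | Q (⋃ s ∈ S, openEdgeCluster ω s)} +
      (prodBernoulli w).real ({ω : BondConfig V | Q (⋃ s ∈ S, openEdgeCluster ω s)} ∩
          {ω : BondConfig V | ∀ s ∈ S, ∀ t ∈ T, ¬ (openGraph ω).Reachable s t}) *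
        (prodBernoulli w).real {ω : BondConfig V | P (⋃ s ∈ S, openEdgeCluster ω s)} ≤
    (prodBernoulli w).real ({ω : BondConfig V | P (⋃ s ∈ S, openEdgeCluster ω s)} ∩
          {ω : BondConfig V | Q (⋃ s ∈ S, openEdgeCluster ω s)} ∩
          {ω : BondConfig V | ∀ s ∈ S, ∀ t ∈ T, ¬ (openGraph ω).Reachable s t}) +
      (prodBernoulli w).real {ω : BondConfig V | ∀ s ∈ S, ∀ t ∈ T, ¬ (openGraph ω).Reachable s t} *
        (prodBernoulli w).real ({ω : BondConfig V | P (⋃ s ∈ S, openEdgeCluster ω s)} ∩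
          {ω : BondConfig V | Q (⋃ s ∈ S, openEdgeCluster ω s)}) := by
  -- monotonicity: `A`, `B` are upper sets, `D` is a lower set
  have hmonoC : ∀ ⦃ω ω' : BondConfig V⦄, ω ⊆ ω' →
      (⋃ s ∈ S, openEdgeCluster ω s) ⊆ (⋃ s ∈ S, openEdgeCluster ω' s) :=
    fun ω ω' hle => Set.iUnion₂_mono fun s _ => BHK2006.openEdgeCluster_mono hle s
  have hAup : IsUpperSet {ω : BondConfig V | P (⋃ s ∈ S, openEdgeCluster ω s)} :=
    fun ω ω' hle hω => hP (hmonoC hle) hω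
  have hBup : IsUpperSet {ω : BondConfig V | Q (⋃ s ∈ S, openEdgeCluster ω s)} :=
    fun ω ω' hle hω => hQ (hmonoC hle) hω
  have hDlow : IsLowerSet {ω : BondConfig V | ∀ s ∈ S, ∀ t ∈ T, ¬ (openGraph ω).Reachable s t} := by
    intro ω ω' hle hω s hs t ht hr
    exact hω s hs t ht (hr.mono (openGraph_mono hle))
  -- Harris (three times)
  have h4 := prodBernoulli_harris_via_fibres w hAup hBup
  have h2 := prodBernoulli_harris_upper_lower_via_fibres w hAup hDlow
  have h3 := prodBernoulli_harris_upper_lower_via_fibres w hBup hDlow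
  -- BHK Theorem 1.3 with sets on `D = {S ↮ T}`
  have h1 := setClusterEventExchange w S T P Q (fun _ => True) (fun _ => True) hP hQ
    (fun _ _ _ _ => trivial) (fun _ _ _ _ => trivial)
  simp only [setOf_true, inter_univ] at h1
  rw [inter_comm ({ω : BondConfig V | ∀ s ∈ S, ∀ t ∈ T, ¬ (openGraph ω).Reachable s t}),
    inter_comm ({ω : BondConfig V | ∀ s ∈ S, ∀ t ∈ T, ¬ (openGraph ω).Reachable s t}),
    inter_comm ({ω : BondConfig V | ∀ s ∈ S, ∀ t ∈ T, ¬ (openGraph ω).Reachable s t})] at h1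
  -- the real-arithmetic core
  exact oneCopyRepel_algebra _ _ _ _ _ _ _ h1 h2 h3 h4 measureReal_nonneg measureReal_nonneg measureReal_nonneg
    measureReal_nonneg

end Consts

end Summit.CriticalPhenomena.PercolationContinuityZ3.Theorems
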